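import Summits.Ventures.HodgeRepro.FacePattern

/-!
# Single-class quadruples from a cyclic subgroup of order `4` need `|G| ≥ 16`

Blind re-derivation cell `pub-hodge-repro`, seat `p1` (gen 6).  Continues typer's `FacePattern.lean`
(`shared`, `sum_card_shared`, `conj_of_shared_eq_empty`).  The degree-16 witness of
`SingleClass16Witness.lean` is a quadruple of twists `Φ, Φa, Φa², Φa³` by a cyclic subgroup
`Δ = ⟨a⟩` of order `4` not containing `c` (`K'`-Weil classes for the quartic CM subfield `K' = F^Δ`).
This file proves that this mechanism cannot occur below degree 16, for every finite `(G, c)`: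

* `sixteen_le_card_of_cyclicQuad`: if the quadruple `Φ, Φa, Φa², Φa³` (`orderOf a = 4`, `a² ≠ c`) is
  `SumTwo` without a conjugate pair, then `16 ≤ |G|`.

Proof.  Write `S_i = Φ ∩ Φa^i` (typer's `shared`); `|S_1| + |S_2| + |S_3| = |Φ| = |G|/2` and
`|S_3| = |S_1|` (translate by `a³`).  A conjugate pair is excluded, so `S_1, S_2 ≠ ∅`
(`conj_of_shared_eq_empty`).  Every coset `yΔ` meets `Φ` in exactly two elements (`SumTwo` at `y`), and
the CM condition sends the trace of `Φ` on `yΔ` to the COMPLEMENTARY trace on `c yΔ`; hence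
`y ∈ S_1` gives the second element `c y a² ∈ S_1`, and `y ∈ S_2` gives the four elements
`y, y a², c y a, c y a³ ∈ S_2`, pairwise distinct.  So `|S_1| ≥ 2`, `|S_2| ≥ 4` and
`|G|/2 = 2|S_1| + |S_2| ≥ 8`.  (The same parity argument for a Klein subgroup gives `|G| ≥ 24` and the
pattern `(4,4,4)` — Python control `proofs/p1-g6/klein24.out`; not formalised.)
-/

set_option autoImplicit false

open Finset
open scoped Pointwise

namespace HodgeRepro

variable {G : Type*} [Group G]

/-- The quadruple of twists of `Φ` by the powers `1, a, a², a³`. -/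
def cyclicQuad (Φ : Finset G) (a : G) : Fin 4 → Finset G :=
  ![Φ, rmul Φ a, rmul Φ (a ^ 2), rmul Φ (a ^ 3)]

/-- The first corner of `cyclicQuad`. -/
theorem cyclicQuad_zero (Φ : Finset G) (a : G) : cyclicQuad Φ a 0 = Φ := rfl

/-- The second corner of `cyclicQuad`. -/
theorem cyclicQuad_one (Φ : Finset G) (a : G) : cyclicQuad Φ a 1 = rmul Φ a := rfl

/-- The third corner of `cyclicQuad`. -/
theorem cyclicQuad_two (Φ : Finset G) (a : G) : cyclicQuad Φ a 2 = rmul Φ (a ^ 2) := rfl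

/-- The fourth corner of `cyclicQuad`. -/
theorem cyclicQuad_three (Φ : Finset G) (a : G) : cyclicQuad Φ a 3 = rmul Φ (a ^ 3) := rfl

/-- Every corner of `cyclicQuad` of a CM type is a CM type. -/
theorem isCMType_cyclicQuad {c : G} {Φ : Finset G} (hΦ : IsCMType c Φ) (a : G) (i : Fin 4) :
    IsCMType c (cyclicQuad Φ a i) := by
  fin_cases i
  · exact hΦ
  · exact hΦ.rmul a
  · exact hΦ.rmul (a ^ 2)
  · exact hΦ.rmul (a ^ 3)

variable [DecidableEq G] [Fintype G]

/-- **A cyclic-subgroup single-class quadruple without a conjugate pair needs `|G| ≥ 16`.** -/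
theorem sixteen_le_card_of_cyclicQuad {c : G} (hc : IsComplexConj c) {Φ : Finset G}
    (hΦ : IsCMType c Φ) {a : G} (ha : orderOf a = 4) (hac : a ^ 2 ≠ c)
    (hs : SumTwo (cyclicQuad Φ a))
    (hnc : ∀ i j : Fin 4, cyclicQuad Φ a j ≠ c • cyclicQuad Φ a i) : 16 ≤ Fintype.card G := by
  have hT : ∀ i, IsCMType c (cyclicQuad Φ a i) := isCMType_cyclicQuad hΦ a
  -- powers of `a`
  have ha4 : a ^ 4 = 1 := by rw [← ha, pow_orderOf_eq_one]
  have ha2 : a ^ 2 ≠ 1 := by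
    intro h
    have := Nat.le_of_dvd (by norm_num) (orderOf_dvd_iff_pow_eq_one.2 h)
    omega
  have hinv1 : a⁻¹ = a ^ 3 := by
    rw [inv_eq_iff_mul_eq_one, ← pow_succ' a 3]
    exact ha4
  have hinv2 : (a ^ 2)⁻¹ = a ^ 2 := by
    rw [inv_eq_iff_mul_eq_one, ← pow_add]
    exact ha4
  have hinv3 : (a ^ 3)⁻¹ = a := by
    rw [inv_eq_iff_mul_eq_one, ← pow_succ a 3]
    exact ha4
  have ha5 : a ^ 2 * a ^ 3 = a := by
    rw [← pow_add]
    show a ^ (4 + 1) = a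
    rw [pow_succ, ha4, one_mul]
  have ha5' : a ^ 3 * a ^ 2 = a := by
    rw [← pow_add]
    show a ^ (4 + 1) = a
    rw [pow_succ, ha4, one_mul]
  have ha13 : a * a ^ 3 = 1 := by
    rw [← pow_succ' a 3]
    exact ha4
  have hca : c ≠ a := by
    intro h
    exact ha2 (by rw [← h, sq, hc.mul_self])
  have hca3 : c ≠ a ^ 3 := by
    intro h
    apply ha2
    have h6 : a ^ 6 = 1 := by rw [show (6 : ℕ) = 3 + 3 by rfl, pow_add, ← h, hc.mul_self]
    rwa [show (6 : ℕ) = 4 + 2 by rfl, pow_add, ha4, one_mul] at h6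
  -- membership in the corners
  have mem0 : ∀ x, x ∈ cyclicQuad Φ a 0 ↔ x ∈ Φ := fun x => Iff.rfl
  have mem1 : ∀ x, x ∈ cyclicQuad Φ a 1 ↔ x * a ^ 3 ∈ Φ := by
    intro x; rw [cyclicQuad_one, mem_rmul, hinv1]
  have mem2 : ∀ x, x ∈ cyclicQuad Φ a 2 ↔ x * a ^ 2 ∈ Φ := by
    intro x; rw [cyclicQuad_two, mem_rmul, hinv2]
  have mem3 : ∀ x, x ∈ cyclicQuad Φ a 3 ↔ x * a ∈ Φ := by
    intro x; rw [cyclicQuad_three, mem_rmul, hinv3]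
  -- an embedding of `Φ` lies in exactly one other corner
  have partner : ∀ x, x ∈ Φ → ∀ e : Fin 4, e ≠ 0 → x ∈ cyclicQuad Φ a e →
      ∀ i : Fin 4, i ≠ 0 → i ≠ e → x ∉ cyclicQuad Φ a i := by
    intro x hx e he hxe i hi hie hxi
    obtain ⟨e', -, he'⟩ := hs.exists_partner ((mem0 x).2 hx)
    exact hie (((he' i hi).1 hxi).trans ((he' e he).1 hxe).symm)
  -- centrality of `c`
  have hcen : ∀ y w : G, c * (y * w) = y * (c * w) := by
    intro y w; rw [← mul_assoc, hc.comm, mul_assoc]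
  -- the three shared sets
  have hsum := sum_card_shared hs
  rw [cyclicQuad_zero] at hsum
  have h13 : (shared (cyclicQuad Φ a) 3).card = (shared (cyclicQuad Φ a) 1).card := by
    have : shared (cyclicQuad Φ a) 3 = rmul (shared (cyclicQuad Φ a) 1) (a ^ 3) := by
      ext x
      simp only [shared, mem_inter, mem_rmul, cyclicQuad_zero, cyclicQuad_one, cyclicQuad_three,
        hinv1, hinv3]
      rw [mul_assoc, ha13, mul_one]
      exact and_comm
    rw [this, card_rmul]
  -- `S_1 ≠ ∅` and `S_2 ≠ ∅`
  have h1ne : (shared (cyclicQuad Φ a) 1).Nonempty := by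
    rw [Finset.nonempty_iff_ne_empty]
    intro h
    exact hnc 2 3 (conj_of_shared_eq_empty hc hT hs (a := 1) (b := 2) (d := 3)
      (by decide) (by decide) (by decide) (by decide) (by decide) (by decide) h)
  have h2ne : (shared (cyclicQuad Φ a) 2).Nonempty := by
    rw [Finset.nonempty_iff_ne_empty]
    intro h
    exact hnc 1 3 (conj_of_shared_eq_empty hc hT hs (a := 2) (b := 1) (d := 3)
      (by decide) (by decide) (by decide) (by decide) (by decide) (by decide) h)
  -- `|S_1| ≥ 2`: with `y` also `c y a²`
  have h1 : 2 ≤ (shared (cyclicQuad Φ a) 1).card := by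
    obtain ⟨y, hy⟩ := h1ne
    have hy' := hy
    rw [mem_shared, mem0, mem1] at hy
    have hy2 : y ∉ cyclicQuad Φ a 2 :=
      partner y hy.1 1 (by decide) ((mem1 y).2 hy.2) 2 (by decide) (by decide)
    have hy3 : y ∉ cyclicQuad Φ a 3 :=
      partner y hy.1 1 (by decide) ((mem1 y).2 hy.2) 3 (by decide) (by decide)
    rw [mem2] at hy2
    rw [mem3] at hy3
    have hz : c * (y * a ^ 2) ∈ shared (cyclicQuad Φ a) 1 := by
      rw [mem_shared, mem0, mem1]
      refine ⟨(hΦ.conj_mem_iff _).2 hy2, ?_⟩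
      rw [mul_assoc, mul_assoc, ha5]
      exact (hΦ.conj_mem_iff _).2 hy3
    have hzy : c * (y * a ^ 2) ≠ y := by
      intro h
      rw [hcen, mul_eq_left] at h
      exact hac ((eq_inv_of_mul_eq_one_right h).trans hc.inv_eq)
    exact Finset.one_lt_card.2 ⟨_, hz, _, hy', hzy⟩
  -- `|S_2| ≥ 4`: with `y` also `y a²`, `c y a`, `c y a³`
  have h2 : 4 ≤ (shared (cyclicQuad Φ a) 2).card := by
    obtain ⟨y, hy⟩ := h2ne
    have e1 := hy
    rw [mem_shared, mem0, mem2] at hy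
    have hy1 : y ∉ cyclicQuad Φ a 1 :=
      partner y hy.1 2 (by decide) ((mem2 y).2 hy.2) 1 (by decide) (by decide)
    have hy3 : y ∉ cyclicQuad Φ a 3 :=
      partner y hy.1 2 (by decide) ((mem2 y).2 hy.2) 3 (by decide) (by decide)
    rw [mem1] at hy1
    rw [mem3] at hy3
    have e2 : y * a ^ 2 ∈ shared (cyclicQuad Φ a) 2 := by
      rw [mem_shared, mem0, mem2, mul_assoc, ← pow_add]
      show y * a ^ 2 ∈ Φ ∧ y * a ^ 4 ∈ Φ
      rw [ha4, mul_one]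
      exact ⟨hy.2, hy.1⟩
    have e3 : c * (y * a) ∈ shared (cyclicQuad Φ a) 2 := by
      rw [mem_shared, mem0, mem2, mul_assoc, mul_assoc, ← pow_succ']
      exact ⟨(hΦ.conj_mem_iff _).2 hy3, (hΦ.conj_mem_iff _).2 hy1⟩
    have e4 : c * (y * a ^ 3) ∈ shared (cyclicQuad Φ a) 2 := by
      rw [mem_shared, mem0, mem2, mul_assoc, mul_assoc, ha5']
      exact ⟨(hΦ.conj_mem_iff _).2 hy1, (hΦ.conj_mem_iff _).2 hy3⟩
    -- the four are pairwise distinct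
    have d12 : y ≠ y * a ^ 2 := fun h => ha2 (mul_eq_left.1 h.symm)
    have d13 : y ≠ c * (y * a) := by
      intro h
      rw [hcen, eq_comm, mul_eq_left] at h
      exact hca ((eq_inv_of_mul_eq_one_right h).trans hc.inv_eq).symm
    have d14 : y ≠ c * (y * a ^ 3) := by
      intro h
      rw [hcen, eq_comm, mul_eq_left] at h
      exact hca3 ((eq_inv_of_mul_eq_one_right h).trans hc.inv_eq).symm
    have d23 : y * a ^ 2 ≠ c * (y * a) := by
      intro h
      rw [hcen, mul_left_cancel_iff, sq] at h
      exact hca (mul_right_cancel h).symm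
    have d24 : y * a ^ 2 ≠ c * (y * a ^ 3) := by
      intro h
      rw [hcen, mul_left_cancel_iff] at h
      apply hca3
      symm
      calc a ^ 3 = a ^ 2 * a := pow_succ a 2
        _ = c * a ^ 3 * a := by rw [h]
        _ = c * (a ^ 3 * a) := mul_assoc _ _ _
        _ = c * a ^ 4 := by rw [← pow_succ a 3]
        _ = c := by rw [ha4, mul_one]
    have d34 : c * (y * a) ≠ c * (y * a ^ 3) := by
      intro h
      rw [mul_left_cancel_iff, mul_left_cancel_iff] at h
      apply ha2
      have h' : a * a ^ 3 = a ^ 3 * a ^ 3 := by rw [← h]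
      rwa [ha13, ← pow_add, show (3 + 3 : ℕ) = 4 + 2 by rfl, pow_add, ha4, one_mul, eq_comm] at h'
    have hsub : ({y, y * a ^ 2, c * (y * a), c * (y * a ^ 3)} : Finset G) ⊆
        shared (cyclicQuad Φ a) 2 := by
      intro x hx
      simp only [mem_insert, mem_singleton] at hx
      rcases hx with rfl | rfl | rfl | rfl
      · exact e1
      · exact e2
      · exact e3
      · exact e4
    have hcard : ({y, y * a ^ 2, c * (y * a), c * (y * a ^ 3)} : Finset G).card = 4 := by
      rw [card_insert_of_notMem, card_insert_of_notMem, card_pair d34]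
      · simp only [mem_insert, mem_singleton, not_or]
        exact ⟨d23, d24⟩
      · simp only [mem_insert, mem_singleton, not_or]
        exact ⟨d12, d13, d14⟩
    have := Finset.card_le_card hsub
    rwa [hcard] at this
  have h2m := hΦ.two_mul_card hc
  omega

end HodgeRepro
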